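import Mathlib
import HarnessLib
import Summits.Ventures.LatticeQCDFlow.Scoring.Phi4FlowAcceptanceErrorBar
import Summits.Ventures.LatticeQCDFlow.Scaling.AcceptanceJensenFloorIntegral

/-!
# LatticeQCDFlow / Scaling — the lattice φ⁴ flow sampler: the JENSEN FLOOR of its acceptance from
# the training loss and the spread of the log-weight, for ANY positive model density

HONEST FRAMING: exact (Metropolis-corrected) sampling algorithms for lattice gauge theory;
figures of merit are autocorrelation/cost numbers at stated couplings and volumes; no
continuum-physics claim.

Venture `LatticeQCDFlow` (cell pub-lqcd), topic `Scaling`; FANOUT row 3 (`s0-u1-a`, S0-B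
implementation A — deliverable 'training curves', GEN-11).  NEW WORK of the cell (specialisation):
row 3's general-space law `Scaling/AcceptanceJensenFloorIntegral` (imported) instantiated for row 2's
lattice φ⁴ flow sampler in the vocabulary of `Scoring/SchwingerDysonPhi4Gibbs` /
`Scoring/Phi4FlowAcceptanceErrorBar` (imported, `phi4Target_normalised`): sites `Fin (m + 1)`,
configurations `φ : Fin (m + 1) → ℝ` with Lebesgue reference measure, Gibbs density
`e^{−S} = gibbsWeight J λ` (`λ > 0`, any real coupling matrix `J`, `S = latticePhi4Action J λ`),
target `p = e^{−S}/Z`, ANY positive measurable model density `q̃` with `∫ q̃ = 1` (the trained flow's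
push-forward density, law `ν = q̃ dφ`), importance ratio `w = p/q̃`, `ℓ = log w = −S − log Z − log q̃`,
and `acc = ∫∫ min(p(φ)q̃(φ′), p(φ′)q̃(φ)) dφ dφ′`.  NO weight ceiling; NO definition is introduced.

* `phi4Model_isProbabilityMeasure` — `ν = q̃ dφ` is a probability measure;
* `phi4Flow_integral_logWeight_eq` — `E_ν[ℓ] = −(E_ν[S + log q̃] + log Z)`: minus (the trainer's
  reverse-KL loss `E_q̃[log q̃ + S]` plus `log Z`), i.e. `−D(q̃‖p)`;
* **`phi4Flow_meanAccept_ge_exp_jensen`** — for `ℓ ∈ L¹(ν)`: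
  `acc ≥ exp(E_ν[ℓ] − ½·∫∫ |ℓ(φ) − ℓ(φ′)| dν dν)`;
* **`phi4Flow_meanAccept_ge_exp_jensen_sd`** — for `ℓ ∈ L²(ν)`:
  `acc ≥ exp(E_ν[ℓ] − √(Var_ν(ℓ)/2))`: at every checkpoint of a φ⁴ flow, whatever the network, the
  equilibrium acceptance of the exact chain is at least `exp(−(loss + log Z) − σ/√2)` with `σ` the
  standard deviation of the log-weight over model draws.

NOT CLAIMED: any acceptance, loss or `Z` of ours; gauge targets (the general-space file applies
verbatim once the densities are typed); nothing re-scored.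
-/

namespace Summit.Ventures.LatticeQCDFlow.Scoring

open MeasureTheory ProbabilityTheory Finset
open Summit.Ventures.LatticeQCDFlow.Theory2

section Phi4Jensen

variable {m : ℕ}

/-- **The model law `q̃ dφ` is a probability measure** for a positive `q̃` with `∫ q̃ = 1`.
[folklore] -/
theorem phi4Model_isProbabilityMeasure {q : (Fin (m + 1) → ℝ) → ℝ} (hq0 : ∀ φ, 0 < q φ)
    (hqi : Integrable q) (hq1 : ∫ φ, q φ = 1) :
    IsProbabilityMeasure ((volume : Measure (Fin (m + 1) → ℝ)).withDensity
      fun φ => ENNReal.ofReal (q φ)) := by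
  refine ⟨?_⟩
  rw [withDensity_apply _ MeasurableSet.univ, Measure.restrict_univ,
    ← ofReal_integral_eq_lintegral_ofReal hqi (Filter.Eventually.of_forall fun φ => (hq0 φ).le),
    hq1, ENNReal.ofReal_one]

/-- **`E_ν[log w] = −(E_ν[S + log q̃] + log Z)`**: the mean log-weight under the model is minus the
reverse-KL training loss (plus `log Z`). [ours] -/
theorem phi4Flow_integral_logWeight_eq {lam : ℝ} (J : Fin (m + 1) → Fin (m + 1) → ℝ)
    {q : (Fin (m + 1) → ℝ) → ℝ} (hq0 : ∀ φ, 0 < q φ) (hqi : Integrable q) (hq1 : ∫ φ, q φ = 1)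
    (hZ : 0 < ∫ ψ, gibbsWeight J lam ψ)
    (hL : Integrable (fun φ => latticePhi4Action J lam φ + Real.log (q φ))
      ((volume : Measure (Fin (m + 1) → ℝ)).withDensity fun φ => ENNReal.ofReal (q φ))) :
    ∫ φ, Real.log (gibbsWeight J lam φ / (∫ ψ, gibbsWeight J lam ψ) / q φ)
        ∂((volume : Measure (Fin (m + 1) → ℝ)).withDensity fun φ => ENNReal.ofReal (q φ))
      = -((∫ φ, (latticePhi4Action J lam φ + Real.log (q φ))
            ∂((volume : Measure (Fin (m + 1) → ℝ)).withDensity fun φ => ENNReal.ofReal (q φ)))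
          + Real.log (∫ ψ, gibbsWeight J lam ψ)) := by
  haveI := phi4Model_isProbabilityMeasure hq0 hqi hq1
  have e : ∀ φ, Real.log (gibbsWeight J lam φ / (∫ ψ, gibbsWeight J lam ψ) / q φ)
      = -(latticePhi4Action J lam φ + Real.log (q φ)) - Real.log (∫ ψ, gibbsWeight J lam ψ) := by
    intro φ
    rw [Real.log_div (div_pos (gibbsWeight_pos J lam φ) hZ).ne' (hq0 φ).ne',
      Real.log_div (gibbsWeight_pos J lam φ).ne' hZ.ne', gibbsWeight, Real.log_exp]
    ring
  simp_rw [e]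
  have hL' : Integrable (fun φ => -(latticePhi4Action J lam φ + Real.log (q φ)))
      ((volume : Measure (Fin (m + 1) → ℝ)).withDensity fun φ => ENNReal.ofReal (q φ)) := hL.neg
  rw [integral_sub hL' (integrable_const _), integral_neg, integral_const, smul_eq_mul,
    probReal_univ, one_mul]
  ring

/-- **φ⁴ FLOW, THE JENSEN FLOOR**: for any positive model density with `log w ∈ L¹(q̃ dφ)`,
`exp(E_ν[log w] − ½·∫∫ |log w(φ) − log w(φ′)| dν dν) ≤ acc`. [ours] -/
theorem phi4Flow_meanAccept_ge_exp_jensen {lam : ℝ} (hlam : 0 < lam)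
    (J : Fin (m + 1) → Fin (m + 1) → ℝ) {q : (Fin (m + 1) → ℝ) → ℝ} (hq0 : ∀ φ, 0 < q φ)
    (hqm : Measurable q) (hqi : Integrable q) (hq1 : ∫ φ, q φ = 1)
    (hℓ : Integrable (fun φ => Real.log (gibbsWeight J lam φ / (∫ ψ, gibbsWeight J lam ψ) / q φ))
      ((volume : Measure (Fin (m + 1) → ℝ)).withDensity fun φ => ENNReal.ofReal (q φ))) :
    Real.exp ((∫ φ, Real.log (gibbsWeight J lam φ / (∫ ψ, gibbsWeight J lam ψ) / q φ)
          ∂((volume : Measure (Fin (m + 1) → ℝ)).withDensity fun φ => ENNReal.ofReal (q φ)))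
        - (∫ φ, ∫ φ', |Real.log (gibbsWeight J lam φ / (∫ ψ, gibbsWeight J lam ψ) / q φ)
              - Real.log (gibbsWeight J lam φ' / (∫ ψ, gibbsWeight J lam ψ) / q φ')|
            ∂((volume : Measure (Fin (m + 1) → ℝ)).withDensity fun φ => ENNReal.ofReal (q φ))
            ∂((volume : Measure (Fin (m + 1) → ℝ)).withDensity fun φ => ENNReal.ofReal (q φ))) / 2)
      ≤ ∫ φ, ∫ φ', min (gibbsWeight J lam φ / (∫ ψ, gibbsWeight J lam ψ) * q φ')
          (gibbsWeight J lam φ' / (∫ ψ, gibbsWeight J lam ψ) * q φ) := by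
  haveI := phi4Model_isProbabilityMeasure hq0 hqi hq1
  obtain ⟨hZ, -, hpm, hpi, -⟩ := phi4Target_normalised hlam J hq1
  have hp0 : ∀ φ, 0 < gibbsWeight J lam φ / ∫ ψ, gibbsWeight J lam ψ :=
    fun φ => div_pos (gibbsWeight_pos J lam φ) hZ
  exact exp_integral_log_sub_half_mad_le_meanAccept (μ := volume) hp0 hpm hpi hq0 hqm hqi hℓ

/-- **φ⁴ FLOW, STANDARD-DEVIATION FORM**: for any positive model density with `log w ∈ L²(q̃ dφ)`,
`exp(E_ν[log w] − √(Var_ν(log w)/2)) ≤ acc`. [ours] -/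
theorem phi4Flow_meanAccept_ge_exp_jensen_sd {lam : ℝ} (hlam : 0 < lam)
    (J : Fin (m + 1) → Fin (m + 1) → ℝ) {q : (Fin (m + 1) → ℝ) → ℝ} (hq0 : ∀ φ, 0 < q φ)
    (hqm : Measurable q) (hqi : Integrable q) (hq1 : ∫ φ, q φ = 1)
    (hℓ2 : MemLp (fun φ => Real.log (gibbsWeight J lam φ / (∫ ψ, gibbsWeight J lam ψ) / q φ)) 2
      ((volume : Measure (Fin (m + 1) → ℝ)).withDensity fun φ => ENNReal.ofReal (q φ))) :
    Real.exp ((∫ φ, Real.log (gibbsWeight J lam φ / (∫ ψ, gibbsWeight J lam ψ) / q φ)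
          ∂((volume : Measure (Fin (m + 1) → ℝ)).withDensity fun φ => ENNReal.ofReal (q φ)))
        - Real.sqrt (((∫ φ, Real.log (gibbsWeight J lam φ / (∫ ψ, gibbsWeight J lam ψ) / q φ) ^ 2
              ∂((volume : Measure (Fin (m + 1) → ℝ)).withDensity fun φ => ENNReal.ofReal (q φ)))
            - (∫ φ, Real.log (gibbsWeight J lam φ / (∫ ψ, gibbsWeight J lam ψ) / q φ)
              ∂((volume : Measure (Fin (m + 1) → ℝ)).withDensity fun φ => ENNReal.ofReal (q φ))) ^ 2)
            / 2))
      ≤ ∫ φ, ∫ φ', min (gibbsWeight J lam φ / (∫ ψ, gibbsWeight J lam ψ) * q φ')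
          (gibbsWeight J lam φ' / (∫ ψ, gibbsWeight J lam ψ) * q φ) := by
  haveI := phi4Model_isProbabilityMeasure hq0 hqi hq1
  obtain ⟨hZ, -, hpm, hpi, -⟩ := phi4Target_normalised hlam J hq1
  have hp0 : ∀ φ, 0 < gibbsWeight J lam φ / ∫ ψ, gibbsWeight J lam ψ :=
    fun φ => div_pos (gibbsWeight_pos J lam φ) hZ
  exact exp_integral_log_sub_sqrt_half_var_le_meanAccept (μ := volume) hp0 hpm hpi hq0 hqm hqi hℓ2

end Phi4Jensen

end Summit.Ventures.LatticeQCDFlow.Scoring
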